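import Mathlib.AlgebraicGeometry.AlgClosed.Basic
import Mathlib.AlgebraicGeometry.Morphisms.Proper
import Mathlib.AlgebraicGeometry.Morphisms.Smooth
import Mathlib.AlgebraicGeometry.Morphisms.Separated
import Mathlib.AlgebraicGeometry.ProjectiveSpectrum.Basic
import Mathlib.AlgebraicGeometry.ProjectiveSpectrum.Proper
import Mathlib.AlgebraicGeometry.AffineSpace
import Mathlib.RingTheory.MvPolynomial.Homogeneous
import Mathlib.Analysis.Complex.Polynomial.Basic
import Mathlib.Analysis.Analytic.Polynomial
import Mathlib.Geometry.Manifold.MFDeriv.Defs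
import Mathlib.Geometry.Manifold.MFDeriv.FDeriv
import Mathlib.Topology.Algebra.MvPolynomial
import Mathlib.Topology.Homeomorph.Defs
import Summits.Ventures.HodgeRepro2.HostAPI.Carriers.AlgebraicGeometry.Motives.Varieties
import Summits.Ventures.HodgeRepro2.HostAPI.Carriers.AlgebraicGeometry.Motives.AlgPoints
import Summits.Ventures.HodgeRepro2.HostAPI.Carriers.NumberTheory.Transcendental.ProjectiveSpace
import Summits.Ventures.HodgeRepro2.HostAPI.Util.ForallBinderLint
open HostAPI.Carriers

noncomputable section

universe u

open CategoryTheory AlgebraicGeometry Topology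
open scoped Manifold ContDiff LinearAlgebra.Projectivization

namespace HostAPI.Carriers.NumberTheory.Transcendental

section AlgPoints
open HostAPI.Carriers.AlgebraicGeometry.Motives (AlgPoints)
open HostAPI.Carriers.AlgebraicGeometry.Motives.AlgPoints

variable {k : Type u} [Field k] {X Y : HostAPI.Carriers.AlgebraicGeometry.Motives.SchemeOver k} {L : Type u} [Field L] [Algebra k L]

open Classical in

def _root_.HostAPI.Carriers.AlgebraicGeometry.Motives.AlgPoints.evalOrZero (U : X.left.Opens) (f : Γ(X.left, U)) (P : AlgPoints X L) : L :=
  if h : P.pt ∈ U then P.eval U h f else 0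

theorem _root_.HostAPI.Carriers.AlgebraicGeometry.Motives.AlgPoints.evalOrZero_of_mem {U : X.left.Opens} (f : Γ(X.left, U)) {P : AlgPoints X L}
    (h : P.pt ∈ U) : evalOrZero U f P = P.eval U h f :=
  dif_pos h

theorem _root_.HostAPI.Carriers.AlgebraicGeometry.Motives.AlgPoints.evalOrZero_of_not_mem {U : X.left.Opens} (f : Γ(X.left, U)) {P : AlgPoints X L}
    (h : P.pt ∉ U) : evalOrZero U f P = 0 :=
  dif_neg h

theorem _root_.HostAPI.Carriers.AlgebraicGeometry.Motives.AlgPoints.basicSet_eq_setOf (U : X.left.Opens) (f : Γ(X.left, U)) (V : Set L) :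
    basicSet U f V = {P : AlgPoints X L | P.pt ∈ U ∧ evalOrZero U f P ∈ V} := by
  ext P
  constructor
  · rintro ⟨h, hV⟩
    exact ⟨h, by rwa [evalOrZero_of_mem f h]⟩
  · rintro ⟨h, hV⟩
    exact ⟨h, by rwa [evalOrZero_of_mem f h] at hV⟩

variable [TopologicalSpace L]

theorem _root_.HostAPI.Carriers.AlgebraicGeometry.Motives.AlgPoints.isOpen_setOf_pt_mem (U : X.left.Opens) : IsOpen {P : AlgPoints X L | P.pt ∈ U} := by
  convert isOpen_basicSet (X := X) (L := L) U 0 isOpen_univ using 1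
  ext P
  simp [basicSet]

theorem _root_.HostAPI.Carriers.AlgebraicGeometry.Motives.AlgPoints.continuousOn_evalOrZero (U : X.left.Opens) (f : Γ(X.left, U)) :
    ContinuousOn (evalOrZero U f) {P : AlgPoints X L | P.pt ∈ U} := by
  rw [continuousOn_open_iff (isOpen_setOf_pt_mem U)]
  intro V hV
  convert isOpen_basicSet (X := X) (L := L) U f hV using 1
  rw [basicSet_eq_setOf]
  rfl

theorem _root_.HostAPI.Carriers.AlgebraicGeometry.Motives.AlgPoints.continuous_evalOrZero_top (f : Γ(X.left, ⊤)) :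
    Continuous (evalOrZero ⊤ f : AlgPoints X L → L) := by
  rw [← continuousOn_univ]
  convert continuousOn_evalOrZero (X := X) (L := L) ⊤ f
  simp

def _root_.HostAPI.Carriers.AlgebraicGeometry.Motives.AlgPoints.isOpenEmbedding_map : Prop :=
  ∀ (φ : X ⟶ Y) [IsOpenImmersion φ.left],
    IsOpenEmbedding (map φ : AlgPoints X L → AlgPoints Y L)

def _root_.HostAPI.Carriers.AlgebraicGeometry.Motives.AlgPoints.range_map_of_isOpenImmersion : Prop :=
  ∀ (φ : X ⟶ Y) [IsOpenImmersion φ.left],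
    Set.range (map φ : AlgPoints X L → AlgPoints Y L) = {Q | Q.pt ∈ φ.left.opensRange}

end AlgPoints

theorem specOver_self_hom (k : Type u) [Field k] : (HostAPI.Carriers.AlgebraicGeometry.Motives.specOver k k).hom = 𝟙 (Spec (.of k)) := by
  change Spec.map (CommRingCat.ofHom (algebraMap k k)) = _
  rw [Algebra.algebraMap_self, CommRingCat.ofHom_id, Spec.map_id]

section ComplexPoints
open HostAPI.Carriers.AlgebraicGeometry.Motives (ComplexPoints)

section OverComplex

variable {X : HostAPI.Carriers.AlgebraicGeometry.Motives.SchemeOver ℂ}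

theorem _root_.HostAPI.Carriers.AlgebraicGeometry.Motives.ComplexPoints.toSpecHom_comp_hom (P : ComplexPoints X) : P.toSpecHom ≫ X.hom = 𝟙 _ := by
  rw [← specOver_self_hom ℂ]
  exact Over.w P

theorem _root_.HostAPI.Carriers.AlgebraicGeometry.Motives.ComplexPoints.isClosed_pt (P : ComplexPoints X) : IsClosed ({P.pt} : Set X.left) := by
  have := isClosedImmersion_of_comp_eq_id _ _ P.toSpecHom_comp_hom
  have := P.toSpecHom.isClosedEmbedding.isClosed_range
  rwa [Set.range_eq_singleton] at this
  exact fun x ↦ congr(P.toSpecHom $(Subsingleton.elim _ _))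

variable (X)

def _root_.HostAPI.Carriers.AlgebraicGeometry.Motives.ComplexPoints.homEquiv : ComplexPoints X ≃ {p : Spec (.of ℂ) ⟶ X.left // p ≫ X.hom = 𝟙 _} where
  toFun P := ⟨P.toSpecHom, P.toSpecHom_comp_hom⟩
  invFun p := HostAPI.Carriers.AlgebraicGeometry.Motives.AlgPoints.mk p.1 (by rw [p.2]; exact (specOver_self_hom ℂ).symm)
  left_inv P := by ext : 1; rfl
  right_inv p := rfl

@[simp]
theorem _root_.HostAPI.Carriers.AlgebraicGeometry.Motives.ComplexPoints.coe_homEquiv_apply (P : ComplexPoints X) : (ComplexPoints.homEquiv X P : Spec (.of ℂ) ⟶ X.left) =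
    P.toSpecHom :=
  rfl

def _root_.HostAPI.Carriers.AlgebraicGeometry.Motives.ComplexPoints.equivClosedPoints [LocallyOfFiniteType X.hom] : ComplexPoints X ≃ closedPoints X.left :=
  (ComplexPoints.homEquiv X).trans (pointEquivClosedPoint X.hom)

@[simp]
theorem _root_.HostAPI.Carriers.AlgebraicGeometry.Motives.ComplexPoints.coe_equivClosedPoints_apply [LocallyOfFiniteType X.hom] (P : ComplexPoints X) :
    (ComplexPoints.equivClosedPoints X P : X.left) = P.pt :=
  rfl

variable {X}

theorem _root_.HostAPI.Carriers.AlgebraicGeometry.Motives.ComplexPoints.resHom_eq [LocallyOfFiniteType X.hom] (P : ComplexPoints X) :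
    P.resHom = (residueFieldIsoBase X.hom P.pt P.isClosed_pt).hom := by
  refine ((residueFieldIsoBase X.hom P.pt P.isClosed_pt).inv_comp_eq.mp ?_).trans
    (Category.comp_id _)
  rw [← Spec.map_injective.eq_iff, Spec.map_comp, Spec.map_id, SpecMap_residueFieldIsoBase_inv,
    ← Category.assoc]
  have : Spec.map P.resHom ≫ X.left.fromSpecResidueField P.pt = P.toSpecHom :=
    (X.left.SpecToEquivOfField ℂ).symm_apply_apply P.toSpecHom
  rw [this]
  exact P.toSpecHom_comp_hom

theorem _root_.HostAPI.Carriers.AlgebraicGeometry.Motives.ComplexPoints.eval_eq [LocallyOfFiniteType X.hom] (P : ComplexPoints X) (U : X.left.Opens)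
    (h : P.pt ∈ U) (s : Γ(X.left, U)) :
    P.eval U h s = (residueFieldIsoBase X.hom P.pt P.isClosed_pt).hom
      (X.left.evaluation U P.pt h s) := by
  simp only [HostAPI.Carriers.AlgebraicGeometry.Motives.AlgPoints.eval, ComplexPoints.resHom_eq]

variable (X)

def _root_.HostAPI.Carriers.AlgebraicGeometry.Motives.ComplexPoints.connectedSpace_iff : Prop :=
  ∀ [LocallyOfFiniteType X.hom],
    ConnectedSpace (ComplexPoints X) ↔ ConnectedSpace X.left

end OverComplex

section Subfield

variable {k : Type} [Field k] [Algebra k ℂ] (X : HostAPI.Carriers.AlgebraicGeometry.Motives.SchemeOver k)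

def _root_.HostAPI.Carriers.AlgebraicGeometry.Motives.ComplexPoints.t2Space_iff_isSeparated : Prop :=
  ∀ [LocallyOfFiniteType X.hom],
    T2Space (ComplexPoints X) ↔ IsSeparated X.hom

def _root_.HostAPI.Carriers.AlgebraicGeometry.Motives.ComplexPoints.secondCountableTopology_of_compactSpace : Prop :=
  ∀ [LocallyOfFiniteType X.hom] [CompactSpace X.left],
    SecondCountableTopology (ComplexPoints X)

def _root_.HostAPI.Carriers.AlgebraicGeometry.Motives.ComplexPoints.compactSpace_iff_isProper : Prop :=
  ∀ [LocallyOfFiniteType X.hom] [IsSeparated X.hom],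
    CompactSpace (ComplexPoints X) ↔ IsProper X.hom

end Subfield

end ComplexPoints

section IsAnalytification

structure IsAnalytification (E : Type*) [NormedAddCommGroup E] [NormedSpace ℂ E]
    [FiniteDimensional ℂ E] {M : Type*} [TopologicalSpace M] [ChartedSpace E M]
    {k : Type} [Field k] [Algebra k ℂ] (X : HostAPI.Carriers.AlgebraicGeometry.Motives.SchemeOver k) (d : ℕ) (φ : M → HostAPI.Carriers.AlgebraicGeometry.Motives.ComplexPoints X) :
    Prop where

  isHomeomorph : IsHomeomorph φ

  finrank_eq : Module.finrank ℂ E = d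

  mdifferentiableOn_evalOrZero : ∀ (U : X.left.affineOpens) (s : Γ(X.left, ↑U)),
    MDifferentiableOn 𝓘(ℂ, E) 𝓘(ℂ, ℂ)
      (fun m ↦ HostAPI.Carriers.AlgebraicGeometry.Motives.AlgPoints.evalOrZero (↑U : X.left.Opens) s (φ m))
      (φ ⁻¹' {P | P.pt ∈ (↑U : X.left.Opens)})

variable (E : Type*) [NormedAddCommGroup E] [NormedSpace ℂ E] [FiniteDimensional ℂ E]
  (E' : Type*) [NormedAddCommGroup E'] [NormedSpace ℂ E'] [FiniteDimensional ℂ E']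
  {M : Type*} [TopologicalSpace M] [ChartedSpace E M]
  {M' : Type*} [TopologicalSpace M'] [ChartedSpace E' M']
  {k : Type} [Field k] [Algebra k ℂ] (X : HostAPI.Carriers.AlgebraicGeometry.Motives.SchemeOver k) (d : ℕ) {Y : HostAPI.Carriers.AlgebraicGeometry.Motives.SchemeOver k}

namespace IsAnalytification

variable {E E' X d} {φ : M → HostAPI.Carriers.AlgebraicGeometry.Motives.ComplexPoints X}

def homeomorph (hφ : IsAnalytification E X d φ) : M ≃ₜ HostAPI.Carriers.AlgebraicGeometry.Motives.ComplexPoints X :=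
  hφ.isHomeomorph.homeomorph φ

@[simp]
theorem coe_homeomorph (hφ : IsAnalytification E X d φ) :
    (hφ.homeomorph : M → HostAPI.Carriers.AlgebraicGeometry.Motives.ComplexPoints X) = φ :=
  rfl

theorem isOpen_preimage (hφ : IsAnalytification E X d φ) (U : X.left.Opens) :
    IsOpen (φ ⁻¹' {P | P.pt ∈ U}) :=
  (HostAPI.Carriers.AlgebraicGeometry.Motives.AlgPoints.isOpen_setOf_pt_mem U).preimage hφ.isHomeomorph.continuous

def mdifferentiableOn_evalOrZero_opens : Prop :=
  ∀ (hφ : IsAnalytification E X d φ) (U : X.left.Opens) (s : Γ(X.left, U)),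
    MDifferentiableOn 𝓘(ℂ, E) 𝓘(ℂ, ℂ) (fun m ↦ HostAPI.Carriers.AlgebraicGeometry.Motives.AlgPoints.evalOrZero U s (φ m))
      (φ ⁻¹' {P | P.pt ∈ U})

def t2Space : Prop :=
  ∀ [IsSeparated X.hom] (hφ : IsAnalytification E X d φ),
    T2Space M

def compactSpace : Prop :=
  ∀ [IsProper X.hom] (hφ : IsAnalytification E X d φ),
    CompactSpace M

def secondCountableTopology : Prop :=
  ∀ [LocallyOfFiniteType X.hom] [CompactSpace X.left] (hφ : IsAnalytification E X d φ),
    SecondCountableTopology M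

def unique : Prop :=
  ∀ [LocallyOfFiniteType X.hom] [SmoothOfRelativeDimension d X.hom] [IsManifold 𝓘(ℂ, E) ω M] [IsManifold 𝓘(ℂ, E') ω M'] {ψ : M' → HostAPI.Carriers.AlgebraicGeometry.Motives.ComplexPoints X} (hφ : IsAnalytification E X d φ) (hψ : IsAnalytification E' X d ψ),
    ∃ h : M ≃ₜ M', MDifferentiable 𝓘(ℂ, E) 𝓘(ℂ, E') h ∧
      MDifferentiable 𝓘(ℂ, E') 𝓘(ℂ, E) h.symm ∧ ψ ∘ h = φ

def mdifferentiable_comp_map : Prop :=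
  ∀ [LocallyOfFiniteType X.hom] [LocallyOfFiniteType Y.hom] [SmoothOfRelativeDimension d X.hom] {e : ℕ} [SmoothOfRelativeDimension e Y.hom] [IsManifold 𝓘(ℂ, E) ω M] [IsManifold 𝓘(ℂ, E') ω M'] {ψ : M' → HostAPI.Carriers.AlgebraicGeometry.Motives.ComplexPoints Y} (hφ : IsAnalytification E X d φ) (hψ : IsAnalytification E' Y e ψ) (g : X ⟶ Y) (h : M → M') (hh : ψ ∘ h = HostAPI.Carriers.AlgebraicGeometry.Motives.AlgPoints.map g ∘ φ),
    MDifferentiable 𝓘(ℂ, E) 𝓘(ℂ, E') h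

end IsAnalytification

def exists_isAnalytification : Prop :=
  ∀ [LocallyOfFiniteType X.hom] [SmoothOfRelativeDimension d X.hom] [IsSeparated X.hom],
    ∃ (M : Type) (_ : TopologicalSpace M) (_ : T2Space M) (_ : ChartedSpace (Fin d → ℂ) M)
      (_ : IsManifold 𝓘(ℂ, Fin d → ℂ) ω M) (φ : M → HostAPI.Carriers.AlgebraicGeometry.Motives.ComplexPoints X),
      IsAnalytification (Fin d → ℂ) X d φ

end IsAnalytification

section Affine

abbrev affineSpaceOver (σ : Type u) (k : Type u) [Field k] : HostAPI.Carriers.AlgebraicGeometry.Motives.SchemeOver k :=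
  Over.mk (𝔸(σ; Spec (.of k)) ↘ Spec (.of k))

instance locallyOfFiniteType_affineSpaceOver_hom (σ : Type u) [Finite σ] (k : Type u) [Field k] :
    LocallyOfFiniteType (affineSpaceOver σ k).hom :=
  inferInstanceAs <| LocallyOfFiniteType (𝔸(σ; Spec (.of k)) ↘ Spec (.of k))

instance isSeparated_affineSpaceOver_hom (σ : Type u) (k : Type u) [Field k] :
    IsSeparated (affineSpaceOver σ k).hom :=
  inferInstanceAs <| IsSeparated (𝔸(σ; Spec (.of k)) ↘ Spec (.of k))

def smoothOfRelativeDimension_affineSpace : Prop :=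
  ∀ (σ : Type u) [Finite σ] (k : Type u) [Field k],
    SmoothOfRelativeDimension (Nat.card σ) (affineSpaceOver σ k).hom

def exists_isAnalytification_affineSpace : Prop :=
  ∀ (d : ℕ),
    ∃ φ : (Fin d → ℂ) → HostAPI.Carriers.AlgebraicGeometry.Motives.ComplexPoints (affineSpaceOver (Fin d) ℂ),
      IsAnalytification (Fin d → ℂ) (affineSpaceOver (Fin d) ℂ) d φ ∧
      ∀ (w : Fin d → ℂ) (i : Fin d),
        HostAPI.Carriers.AlgebraicGeometry.Motives.AlgPoints.evalOrZero ⊤ (AffineSpace.coord (Spec (.of ℂ)) i) (φ w) = w i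

end Affine

section GradeZero

instance isScalarTower_gradeZero {ι S R : Type*} [AddMonoid ι] [CommSemiring S]
    [CommSemiring R] [Algebra S R] (A : ι → Submodule S R) [SetLike.GradedMonoid A] :
    IsScalarTower S (A 0) R :=
  IsScalarTower.of_algebraMap_eq (fun _ ↦ rfl)

end GradeZero

section Proj

open _root_.Projectivization HostAPI.Carriers.Projectivization

attribute [local instance] MvPolynomial.gradedAlgebra

variable (σ : Type*) (k : Type u) [Field k]

theorem algebraMap_homogeneousSubmodule_zero_bijective :
    Function.Bijective (algebraMap k (MvPolynomial.homogeneousSubmodule σ k 0)) := by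
  refine ⟨fun a b h ↦ by simpa using congrArg Subtype.val h, ?_⟩
  rintro ⟨p, hp⟩
  rw [MvPolynomial.mem_homogeneousSubmodule, ← MvPolynomial.totalDegree_zero_iff_isHomogeneous,
    MvPolynomial.totalDegree_eq_zero_iff_eq_C] at hp
  exact ⟨p.coeff 0, Subtype.ext (by simpa using hp.symm)⟩

instance finiteType_homogeneousSubmodule_zero [Finite σ] :
    Algebra.FiniteType (MvPolynomial.homogeneousSubmodule σ k 0) (MvPolynomial σ k) :=
  Algebra.FiniteType.of_restrictScalars_finiteType k _ _

variable (n : ℕ)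

instance isIso_specMap_algebraMap_homogeneousSubmodule_zero :
    IsIso (Spec.map (CommRingCat.ofHom
      (algebraMap k (MvPolynomial.homogeneousSubmodule (Fin (n + 1)) k 0)))) := by
  have : IsIso (CommRingCat.ofHom
      (algebraMap k (MvPolynomial.homogeneousSubmodule (Fin (n + 1)) k 0))) := by
    rw [ConcreteCategory.isIso_iff_bijective]
    exact algebraMap_homogeneousSubmodule_zero_bijective (Fin (n + 1)) k
  infer_instance

theorem projectiveSpace_left :
    (HostAPI.Carriers.AlgebraicGeometry.Motives.projectiveSpace n k).left = Proj (MvPolynomial.homogeneousSubmodule (Fin (n + 1)) k) :=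
  rfl

theorem projectiveSpace_hom :
    (HostAPI.Carriers.AlgebraicGeometry.Motives.projectiveSpace n k).hom =
      Proj.toSpecZero (MvPolynomial.homogeneousSubmodule (Fin (n + 1)) k) ≫
        Spec.map (CommRingCat.ofHom
          (algebraMap k (MvPolynomial.homogeneousSubmodule (Fin (n + 1)) k 0))) :=
  rfl

instance isProper_projectiveSpace_hom : IsProper (HostAPI.Carriers.AlgebraicGeometry.Motives.projectiveSpace n k).hom := by

  change IsProper (Proj.toSpecZero (MvPolynomial.homogeneousSubmodule (Fin (n + 1)) k) ≫
    Spec.map (CommRingCat.ofHom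
      (algebraMap k (MvPolynomial.homogeneousSubmodule (Fin (n + 1)) k 0))))
  infer_instance

def smoothOfRelativeDimension_projectiveSpace : Prop :=
  SmoothOfRelativeDimension n (HostAPI.Carriers.AlgebraicGeometry.Motives.projectiveSpace n k).hom

def exists_isAnalytification_proj : Prop :=
  ∀ (n : ℕ),
    ∃ φ : ℙ ℂ (Fin (n + 1) → ℂ) → HostAPI.Carriers.AlgebraicGeometry.Motives.ComplexPoints (HostAPI.Carriers.AlgebraicGeometry.Motives.projectiveSpace n ℂ),
      IsAnalytification (Fin n → ℂ) (HostAPI.Carriers.AlgebraicGeometry.Motives.projectiveSpace n ℂ) n φ ∧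
      ∀ (F : MvPolynomial (Fin (n + 1)) ℂ) (m : ℕ), F.IsHomogeneous m →
        φ ⁻¹' {P | P.pt ∈
          Proj.basicOpen (MvPolynomial.homogeneousSubmodule (Fin (n + 1)) ℂ) F} =
          (projZeroLocus {F})ᶜ

end Proj

section AlgPoints
open HostAPI.Carriers.AlgebraicGeometry.Motives (AlgPoints)
open HostAPI.Carriers.AlgebraicGeometry.Motives.AlgPoints

variable {k : Type u} [Field k] {X Y : HostAPI.Carriers.AlgebraicGeometry.Motives.SchemeOver k} {L : Type u} [Field L] [Algebra k L]

theorem _root_.HostAPI.Carriers.AlgebraicGeometry.Motives.AlgPoints.map_injective (φ : X ⟶ Y) [Mono φ.left] :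
    Function.Injective (map φ : AlgPoints X L → AlgPoints Y L) := by
  intro P Q h
  have h' := congrArg CommaMorphism.left h
  simp only [map, Over.comp_left, cancel_mono] at h'
  ext : 1
  exact h'

theorem _root_.HostAPI.Carriers.AlgebraicGeometry.Motives.AlgPoints.basicSet_map_eqToHom {U V : X.left.Opens} (e : U = V) (f : Γ(X.left, V)) (W : Set L) :
    basicSet U (X.left.presheaf.map (eqToHom e).op f) W = basicSet V f W := by
  subst e
  simp

theorem _root_.HostAPI.Carriers.AlgebraicGeometry.Motives.AlgPoints.preimage_map_basicSet_image (φ : X ⟶ Y) [IsOpenImmersion φ.left] (U : X.left.Opens)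
    (f : Γ(X.left, U)) (V : Set L) :
    map φ ⁻¹' (basicSet (φ.left ''ᵁ U) ((φ.left.appIso U).inv f) V : Set (AlgPoints Y L)) =
      basicSet U f V := by
  rw [preimage_map_basicSet, Scheme.Hom.appIso_inv_app_apply, basicSet_map_eqToHom]

def _root_.HostAPI.Carriers.AlgebraicGeometry.Motives.AlgPoints.liftOfMemOpensRange (φ : X ⟶ Y) [IsOpenImmersion φ.left] (Q : AlgPoints Y L)
    (hQ : Q.pt ∈ φ.left.opensRange) : AlgPoints X L :=
  AlgPoints.mk
    (IsOpenImmersion.lift φ.left Q.toSpecHom (by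
      rintro _ ⟨y, rfl⟩
      obtain rfl : y = IsLocalRing.closedPoint L := Subsingleton.elim _ _
      exact hQ))
    (by rw [← Over.w φ, IsOpenImmersion.lift_fac_assoc]; exact Over.w Q)

@[simp]
theorem _root_.HostAPI.Carriers.AlgebraicGeometry.Motives.AlgPoints.map_liftOfMemOpensRange (φ : X ⟶ Y) [IsOpenImmersion φ.left] (Q : AlgPoints Y L)
    (hQ : Q.pt ∈ φ.left.opensRange) : map φ (liftOfMemOpensRange φ Q hQ) = Q := by
  ext : 1
  simp only [map, liftOfMemOpensRange, Over.comp_left, Over.homMk_left]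
  exact IsOpenImmersion.lift_fac _ _ _

theorem _root_.HostAPI.Carriers.AlgebraicGeometry.Motives.AlgPoints.range_map_of_isOpenImmersion_holds :
    range_map_of_isOpenImmersion (X := X) (Y := Y) (L := L) := by
  intro φ _
  ext Q
  constructor
  · rintro ⟨P, rfl⟩
    exact ⟨P.pt, rfl⟩
  · intro hQ
    exact ⟨liftOfMemOpensRange φ Q hQ, map_liftOfMemOpensRange φ Q hQ⟩

variable [TopologicalSpace L]

theorem _root_.HostAPI.Carriers.AlgebraicGeometry.Motives.AlgPoints.isInducing_map (φ : X ⟶ Y) [IsOpenImmersion φ.left] :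
    IsInducing (map φ : AlgPoints X L → AlgPoints Y L) := by
  refine ⟨le_antisymm (continuous_map φ).le_induced ?_⟩
  refine TopologicalSpace.le_generateFrom_iff_subset_isOpen.mpr ?_
  rintro _ ⟨U, f, V, hV, rfl⟩
  exact isOpen_induced_iff.mpr ⟨_, isOpen_basicSet _ _ hV, preimage_map_basicSet_image φ U f V⟩

theorem _root_.HostAPI.Carriers.AlgebraicGeometry.Motives.AlgPoints.isEmbedding_map (φ : X ⟶ Y) [IsOpenImmersion φ.left] :
    IsEmbedding (map φ : AlgPoints X L → AlgPoints Y L) :=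
  ⟨isInducing_map φ, map_injective φ⟩

theorem _root_.HostAPI.Carriers.AlgebraicGeometry.Motives.AlgPoints.isOpen_range_map (φ : X ⟶ Y) [IsOpenImmersion φ.left] :
    IsOpen (Set.range (map φ : AlgPoints X L → AlgPoints Y L)) := by
  rw [range_map_of_isOpenImmersion_holds φ]
  exact isOpen_setOf_pt_mem _

theorem _root_.HostAPI.Carriers.AlgebraicGeometry.Motives.AlgPoints.isOpenEmbedding_map_holds : isOpenEmbedding_map (X := X) (Y := Y) (L := L) := by
  intro φ _
  exact ⟨isEmbedding_map φ, isOpen_range_map φ⟩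

end AlgPoints

section AlgPoints
open HostAPI.Carriers.AlgebraicGeometry.Motives (AlgPoints)
open HostAPI.Carriers.AlgebraicGeometry.Motives.AlgPoints

variable {k : Type u} [Field k] {X : HostAPI.Carriers.AlgebraicGeometry.Motives.SchemeOver k} {L : Type u} [Field L] [Algebra k L]

theorem _root_.HostAPI.Carriers.AlgebraicGeometry.Motives.AlgPoints.eval_top (P : AlgPoints X L) (f : Γ(X.left, ⊤)) :
    P.eval ⊤ trivial f = (Scheme.ΓSpecIso (.of L)).hom (P.toSpecHom.appTop f) := by
  change (X.left.descResidueField (Scheme.stalkClosedPointTo P.left))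
    ((X.left.presheaf.germ ⊤ _ trivial ≫ X.left.residue _) f) = _
  rw [CategoryTheory.comp_apply, ← CategoryTheory.comp_apply (X.left.residue _),
    Scheme.residue_descResidueField, ← CategoryTheory.comp_apply,
    Scheme.germ_stalkClosedPointTo P.left ⊤ trivial]
  simp only [TopologicalSpace.Opens.map_top, eqToIso_refl, Iso.op_refl, Functor.mapIso_refl,
    Iso.refl_trans, CommRingCat.hom_comp, RingHom.coe_comp, Function.comp_apply]

theorem _root_.HostAPI.Carriers.AlgebraicGeometry.Motives.AlgPoints.eval_res (P : AlgPoints X L) {U V : X.left.Opens} (i : V ≤ U) (hV : P.pt ∈ V)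
    (f : Γ(X.left, U)) :
    P.eval V hV (X.left.presheaf.map (homOfLE i).op f) = P.eval U (i hV) f := by
  change P.resHom (((X.left.presheaf.map (homOfLE i).op ≫ X.left.presheaf.germ V P.pt hV) ≫
    X.left.residue _) f) = P.resHom ((X.left.presheaf.germ U P.pt (i hV) ≫ X.left.residue _) f)
  rw [TopCat.Presheaf.germ_res]

def _root_.HostAPI.Carriers.AlgebraicGeometry.Motives.AlgPoints.evalRingHom (P : AlgPoints X L) (U : X.left.Opens) (h : P.pt ∈ U) : Γ(X.left, U) →+* L :=
  (X.left.evaluation U P.pt h ≫ P.resHom).hom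

@[simp]
theorem _root_.HostAPI.Carriers.AlgebraicGeometry.Motives.AlgPoints.evalRingHom_apply (P : AlgPoints X L) (U : X.left.Opens) (h : P.pt ∈ U)
    (f : Γ(X.left, U)) : P.evalRingHom U h f = P.eval U h f :=
  rfl

theorem _root_.HostAPI.Carriers.AlgebraicGeometry.Motives.AlgPoints.pt_mem_basicOpen_iff (P : AlgPoints X L) {U : X.left.Opens} (h : P.pt ∈ U)
    (f : Γ(X.left, U)) : P.pt ∈ X.left.basicOpen f ↔ P.eval U h f ≠ 0 := by
  rw [← Scheme.evaluation_ne_zero_iff_mem_basicOpen _ _ h, AlgPoints.eval,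
    map_ne_zero_iff _ P.resHom.hom.injective]

end AlgPoints

section AffineSpaceSections

def affineSpaceGlobalSectionsIso (n : Type u) (R : CommRingCat.{u}) :
    Γ(𝔸(n; Spec R), ⊤) ≅ CommRingCat.of (MvPolynomial n R) :=
  Scheme.Γ.mapIso (AffineSpace.SpecIso n R).symm.op ≪≫ Scheme.ΓSpecIso (.of (MvPolynomial n R))

theorem affineSpaceGlobalSectionsIso_hom_apply (n : Type u) (R : CommRingCat.{u})
    (p : Γ(𝔸(n; Spec R), ⊤)) :
    (affineSpaceGlobalSectionsIso n R).hom p =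
      (Scheme.ΓSpecIso (.of (MvPolynomial n R))).hom ((AffineSpace.SpecIso n R).inv.appTop p) :=
  rfl

theorem affineSpaceGlobalSectionsIso_hom_coord (n : Type u) (R : CommRingCat.{u}) (i : n) :
    (affineSpaceGlobalSectionsIso n R).hom (AffineSpace.coord (Spec R) i) = MvPolynomial.X i := by
  rw [affineSpaceGlobalSectionsIso_hom_apply, AffineSpace.SpecIso_inv_appTop_coord]
  exact CommRingCat.hom_inv_apply _ _

end AffineSpaceSections

section AlgPoints
open HostAPI.Carriers.AlgebraicGeometry.Motives (AlgPoints)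
open HostAPI.Carriers.AlgebraicGeometry.Motives.AlgPoints

variable {k : Type u} [Field k] {L : Type u} [Field L] [Algebra k L] {σ : Type u}

variable (k) in

def _root_.HostAPI.Carriers.AlgebraicGeometry.Motives.AlgPoints.affinePoint (w : σ → L) : AlgPoints (affineSpaceOver σ k) L :=
  AlgPoints.mk (Spec.map (CommRingCat.ofHom (MvPolynomial.aeval w).toRingHom) ≫
      (AffineSpace.SpecIso σ (.of k)).inv) (by
    change (_ ≫ _) ≫ (𝔸(σ; Spec (.of k)) ↘ Spec (.of k)) = _
    rw [Category.assoc, AffineSpace.SpecIso_inv_over, ← Spec.map_comp, ← CommRingCat.ofHom_comp]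
    congr 2
    ext c
    simp)

theorem _root_.HostAPI.Carriers.AlgebraicGeometry.Motives.AlgPoints.affinePoint_left (w : σ → L) : (affinePoint k w).left =
    Spec.map (CommRingCat.ofHom (MvPolynomial.aeval w).toRingHom) ≫
      (AffineSpace.SpecIso σ (.of k)).inv :=
  rfl

theorem _root_.HostAPI.Carriers.AlgebraicGeometry.Motives.AlgPoints.eval_top_affinePoint (w : σ → L) (p : Γ(𝔸(σ; Spec (.of k)), ⊤)) :
    (affinePoint k w).eval ⊤ trivial p =
      MvPolynomial.aeval w ((affineSpaceGlobalSectionsIso σ (.of k)).hom p) := by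
  rw [AlgPoints.eval_top, affineSpaceGlobalSectionsIso_hom_apply]
  change (Scheme.ΓSpecIso (.of L)).hom ((Spec.map _ ≫ _).appTop p) = _
  rw [Scheme.Hom.comp_appTop, CategoryTheory.comp_apply,
    ← CategoryTheory.comp_apply _ (Scheme.ΓSpecIso _).hom, Scheme.ΓSpecIso_naturality,
    CategoryTheory.comp_apply]
  rfl

theorem _root_.HostAPI.Carriers.AlgebraicGeometry.Motives.AlgPoints.evalOrZero_coord_affinePoint (w : σ → L) (i : σ) :
    evalOrZero ⊤ (AffineSpace.coord (Spec (.of k)) i) (affinePoint k w) = w i := by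
  rw [evalOrZero_of_mem _ (TopologicalSpace.Opens.mem_top _), eval_top_affinePoint,
    affineSpaceGlobalSectionsIso_hom_coord, MvPolynomial.aeval_X]

theorem _root_.HostAPI.Carriers.AlgebraicGeometry.Motives.AlgPoints.pt_affinePoint_mem_basicOpen_iff (w : σ → L) (g : Γ(𝔸(σ; Spec (.of k)), ⊤)) :
    (affinePoint k w).pt ∈ (𝔸(σ; Spec (.of k))).basicOpen g ↔
      MvPolynomial.aeval w ((affineSpaceGlobalSectionsIso σ (.of k)).hom g) ≠ 0 := by
  rw [← eval_top_affinePoint]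
  exact pt_mem_basicOpen_iff (affinePoint k w) (TopologicalSpace.Opens.mem_top _) g

def _root_.HostAPI.Carriers.AlgebraicGeometry.Motives.AlgPoints.affineCoords (P : AlgPoints (affineSpaceOver σ k) L) : σ → L :=
  fun i ↦ evalOrZero ⊤ (AffineSpace.coord (Spec (.of k)) i) P

theorem _root_.HostAPI.Carriers.AlgebraicGeometry.Motives.AlgPoints.affineCoords_apply (P : AlgPoints (affineSpaceOver σ k) L) (i : σ) :
    affineCoords P i = evalOrZero ⊤ (AffineSpace.coord (Spec (.of k)) i) P :=
  rfl

@[simp]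
theorem _root_.HostAPI.Carriers.AlgebraicGeometry.Motives.AlgPoints.affineCoords_affinePoint (w : σ → L) : affineCoords (affinePoint k w) = w :=
  funext fun i ↦ evalOrZero_coord_affinePoint w i

@[simp]
theorem _root_.HostAPI.Carriers.AlgebraicGeometry.Motives.AlgPoints.affinePoint_affineCoords (P : AlgPoints (affineSpaceOver σ k) L) :
    affinePoint k (affineCoords P) = P := by
  apply Over.OverMorphism.ext
  apply AffineSpace.hom_ext
  · exact (Over.w (affinePoint k (affineCoords P))).trans (Over.w P).symm
  · intro i
    have hinj : Function.Injective (Scheme.ΓSpecIso (.of L)).hom :=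
      Function.LeftInverse.injective (g := (Scheme.ΓSpecIso (.of L)).inv)
        (CommRingCat.inv_hom_apply _)
    apply hinj
    change (Scheme.ΓSpecIso (.of L)).hom ((affinePoint k (affineCoords P)).toSpecHom.appTop _) =
      (Scheme.ΓSpecIso (.of L)).hom (P.toSpecHom.appTop _)
    rw [← eval_top, ← eval_top, eval_top_affinePoint, affineSpaceGlobalSectionsIso_hom_coord,
      MvPolynomial.aeval_X]
    exact evalOrZero_of_mem _ (TopologicalSpace.Opens.mem_top _)

variable (k L σ) in

@[simps]
def _root_.HostAPI.Carriers.AlgebraicGeometry.Motives.AlgPoints.affinePointEquiv : (σ → L) ≃ AlgPoints (affineSpaceOver σ k) L where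
  toFun := affinePoint k
  invFun := affineCoords
  left_inv := affineCoords_affinePoint
  right_inv := affinePoint_affineCoords

theorem _root_.HostAPI.Carriers.AlgebraicGeometry.Motives.AlgPoints.continuous_affineCoords [TopologicalSpace L] :
    Continuous (affineCoords : AlgPoints (affineSpaceOver σ k) L → σ → L) :=
  continuous_pi fun _ ↦ continuous_evalOrZero_top _

theorem _root_.HostAPI.Carriers.AlgebraicGeometry.Motives.AlgPoints.exists_evalOrZero_affinePoint_eq_div (U : (𝔸(σ; Spec (.of k))).Opens)
    (s : Γ(𝔸(σ; Spec (.of k)), U)) (g : Γ(𝔸(σ; Spec (.of k)), ⊤))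
    (hgU : (𝔸(σ; Spec (.of k))).basicOpen g ≤ U) :
    ∃ (p : MvPolynomial σ k) (n : ℕ), ∀ w : σ → L,
      MvPolynomial.aeval w ((affineSpaceGlobalSectionsIso σ (.of k)).hom g) ≠ 0 →
        evalOrZero U s (affinePoint k w) = MvPolynomial.aeval w p /
          MvPolynomial.aeval w ((affineSpaceGlobalSectionsIso σ (.of k)).hom g) ^ n := by
  obtain ⟨⟨p, ⟨_, n, rfl⟩⟩, hp⟩ := IsLocalization.surj (Submonoid.powers g)
    ((𝔸(σ; Spec (.of k))).presheaf.map (homOfLE hgU).op s :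
      Γ(𝔸(σ; Spec (.of k)), (𝔸(σ; Spec (.of k))).basicOpen g))
  refine ⟨(affineSpaceGlobalSectionsIso σ (.of k)).hom p, n, fun w hw ↦ ?_⟩
  have hD : (affinePoint k w).pt ∈ (𝔸(σ; Spec (.of k))).basicOpen g :=
    (pt_affinePoint_mem_basicOpen_iff w g).mpr hw
  have hle := (𝔸(σ; Spec (.of k))).basicOpen_le g
  have hp' : (affinePoint k w).eval _ hD
        ((𝔸(σ; Spec (.of k))).presheaf.map (homOfLE hgU).op s) *
      (affinePoint k w).eval _ hD
        ((𝔸(σ; Spec (.of k))).presheaf.map (homOfLE hle).op g) ^ n =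
      (affinePoint k w).eval _ hD
        ((𝔸(σ; Spec (.of k))).presheaf.map (homOfLE hle).op p) := by
    have halg : algebraMap Γ(𝔸(σ; Spec (.of k)), ⊤)
        Γ(𝔸(σ; Spec (.of k)), (𝔸(σ; Spec (.of k))).basicOpen g) =
        ((𝔸(σ; Spec (.of k))).presheaf.map (homOfLE hle).op).hom :=
      RingHom.algebraMap_toAlgebra _
    rw [halg, map_pow] at hp
    rw [← evalRingHom_apply, ← evalRingHom_apply, ← evalRingHom_apply, ← map_pow, ← map_mul]
    exact congrArg ((affinePoint k w).evalRingHom _ hD) hp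
  have e1 : (affinePoint k w).eval _ hD
      ((𝔸(σ; Spec (.of k))).presheaf.map (homOfLE hgU).op s) =
      evalOrZero U s (affinePoint k w) :=
    ((affinePoint k w).eval_res hgU hD s).trans
      (evalOrZero_of_mem (X := affineSpaceOver σ k) s (hgU hD)).symm
  have e2 : ∀ f : Γ(𝔸(σ; Spec (.of k)), ⊤), (affinePoint k w).eval _ hD
      ((𝔸(σ; Spec (.of k))).presheaf.map (homOfLE hle).op f) =
      MvPolynomial.aeval w ((affineSpaceGlobalSectionsIso σ (.of k)).hom f) :=
    fun f ↦ ((affinePoint k w).eval_res hle hD f).trans (eval_top_affinePoint w f)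
  rw [e1, e2, e2] at hp'
  rw [eq_div_iff (pow_ne_zero n hw), hp']

end AlgPoints

section ComplexPoints
open HostAPI.Carriers.AlgebraicGeometry.Motives (ComplexPoints)
open HostAPI.Carriers.AlgebraicGeometry.Motives.ComplexPoints

open MvPolynomial

variable (d : ℕ)

theorem _root_.HostAPI.Carriers.AlgebraicGeometry.Motives.ComplexPoints.eval_top_affinePoint (w : Fin d → ℂ) (p : Γ(𝔸(Fin d; Spec (.of ℂ)), ⊤)) :
    (HostAPI.Carriers.AlgebraicGeometry.Motives.AlgPoints.affinePoint ℂ w).eval ⊤ trivial p =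
      MvPolynomial.eval w ((affineSpaceGlobalSectionsIso (Fin d) (.of ℂ)).hom p) :=
  HostAPI.Carriers.AlgebraicGeometry.Motives.AlgPoints.eval_top_affinePoint w p

theorem _root_.HostAPI.Carriers.AlgebraicGeometry.Motives.ComplexPoints.pt_affinePoint_mem_basicOpen_iff (w : Fin d → ℂ) (g : Γ(𝔸(Fin d; Spec (.of ℂ)), ⊤)) :
    (HostAPI.Carriers.AlgebraicGeometry.Motives.AlgPoints.affinePoint ℂ w).pt ∈ (𝔸(Fin d; Spec (.of ℂ))).basicOpen g ↔
      MvPolynomial.eval w ((affineSpaceGlobalSectionsIso (Fin d) (.of ℂ)).hom g) ≠ 0 :=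
  HostAPI.Carriers.AlgebraicGeometry.Motives.AlgPoints.pt_affinePoint_mem_basicOpen_iff w g

theorem _root_.HostAPI.Carriers.AlgebraicGeometry.Motives.ComplexPoints.isOpen_setOf_pt_affinePoint_mem (U : (𝔸(Fin d; Spec (.of ℂ))).Opens) :
    IsOpen {w : Fin d → ℂ | (HostAPI.Carriers.AlgebraicGeometry.Motives.AlgPoints.affinePoint ℂ w).pt ∈ U} := by
  rw [isOpen_iff_forall_mem_open]
  intro w₀ hw₀
  obtain ⟨_, ⟨_, ⟨g, rfl⟩, rfl⟩, hxg, hgU⟩ :=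
    (isBasis_basicOpen 𝔸(Fin d; Spec (.of ℂ))).exists_subset_of_mem_open hw₀ U.isOpen
  refine ⟨{w | MvPolynomial.eval w ((affineSpaceGlobalSectionsIso (Fin d) (.of ℂ)).hom g) ≠ 0},
    fun w hw ↦ hgU ?_, isOpen_ne_fun (MvPolynomial.continuous_eval _) continuous_const, ?_⟩
  · exact (pt_affinePoint_mem_basicOpen_iff d w g).mpr hw
  · exact (pt_affinePoint_mem_basicOpen_iff d w₀ g).mp hxg

theorem _root_.HostAPI.Carriers.AlgebraicGeometry.Motives.ComplexPoints.differentiableOn_evalOrZero_affinePoint (U : (𝔸(Fin d; Spec (.of ℂ))).Opens)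
    (s : Γ(𝔸(Fin d; Spec (.of ℂ)), U)) :
    DifferentiableOn ℂ (fun w ↦ HostAPI.Carriers.AlgebraicGeometry.Motives.AlgPoints.evalOrZero U s (HostAPI.Carriers.AlgebraicGeometry.Motives.AlgPoints.affinePoint ℂ w))
      {w : Fin d → ℂ | (HostAPI.Carriers.AlgebraicGeometry.Motives.AlgPoints.affinePoint ℂ w).pt ∈ U} := by
  intro w₀ hw₀
  obtain ⟨_, ⟨_, ⟨g, rfl⟩, rfl⟩, hxg, hgU⟩ :=
    (isBasis_basicOpen 𝔸(Fin d; Spec (.of ℂ))).exists_subset_of_mem_open hw₀ U.isOpen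
  obtain ⟨p, n, hpn⟩ := HostAPI.Carriers.AlgebraicGeometry.Motives.AlgPoints.exists_evalOrZero_affinePoint_eq_div (L := ℂ) U s g hgU
  set q : MvPolynomial (Fin d) ℂ := (affineSpaceGlobalSectionsIso (Fin d) (.of ℂ)).hom g with hq
  have hO : IsOpen {w : Fin d → ℂ | MvPolynomial.eval w q ≠ 0} :=
    isOpen_ne_fun (MvPolynomial.continuous_eval _) continuous_const
  have hw₀' : MvPolynomial.eval w₀ q ≠ 0 := (pt_affinePoint_mem_basicOpen_iff d w₀ g).mp hxg
  have hdiff : DifferentiableOn ℂ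
      (fun w ↦ MvPolynomial.eval w p / MvPolynomial.eval w q ^ n)
      {w : Fin d → ℂ | MvPolynomial.eval w q ≠ 0} :=
    (AnalyticOnNhd.div ((AnalyticOnNhd.eval_mvPolynomial p).mono (Set.subset_univ _))
      (((AnalyticOnNhd.eval_mvPolynomial q).mono (Set.subset_univ _)).fun_pow n)
      fun w hw ↦ pow_ne_zero n hw).differentiableOn
  have hdiff' : DifferentiableOn ℂ
      (fun w ↦ HostAPI.Carriers.AlgebraicGeometry.Motives.AlgPoints.evalOrZero U s (HostAPI.Carriers.AlgebraicGeometry.Motives.AlgPoints.affinePoint ℂ w))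
      {w : Fin d → ℂ | MvPolynomial.eval w q ≠ 0} :=
    hdiff.congr fun w hw ↦ hpn w hw
  exact (hdiff'.differentiableAt (hO.mem_nhds hw₀')).differentiableWithinAt

theorem _root_.HostAPI.Carriers.AlgebraicGeometry.Motives.ComplexPoints.continuous_affinePoint :
    Continuous
      (HostAPI.Carriers.AlgebraicGeometry.Motives.AlgPoints.affinePoint ℂ : (Fin d → ℂ) → ComplexPoints (affineSpaceOver (Fin d) ℂ)) := by
  refine continuous_generateFrom_iff.mpr ?_
  rintro _ ⟨U, f, V, hV, rfl⟩
  rw [HostAPI.Carriers.AlgebraicGeometry.Motives.AlgPoints.basicSet_eq_setOf]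
  exact (differentiableOn_evalOrZero_affinePoint d U f).continuousOn.isOpen_inter_preimage
    (isOpen_setOf_pt_affinePoint_mem d U) hV

def _root_.HostAPI.Carriers.AlgebraicGeometry.Motives.ComplexPoints.affineHomeomorph : (Fin d → ℂ) ≃ₜ ComplexPoints (affineSpaceOver (Fin d) ℂ) where
  toEquiv := HostAPI.Carriers.AlgebraicGeometry.Motives.AlgPoints.affinePointEquiv ℂ ℂ (Fin d)
  continuous_toFun := continuous_affinePoint d
  continuous_invFun := HostAPI.Carriers.AlgebraicGeometry.Motives.AlgPoints.continuous_affineCoords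

@[simp]
theorem _root_.HostAPI.Carriers.AlgebraicGeometry.Motives.ComplexPoints.coe_affineHomeomorph :
    (ComplexPoints.affineHomeomorph d : (Fin d → ℂ) → ComplexPoints (affineSpaceOver (Fin d) ℂ)) =
      HostAPI.Carriers.AlgebraicGeometry.Motives.AlgPoints.affinePoint ℂ :=
  rfl

@[simp]
theorem _root_.HostAPI.Carriers.AlgebraicGeometry.Motives.ComplexPoints.coe_affineHomeomorph_symm :
    ((ComplexPoints.affineHomeomorph d).symm : ComplexPoints (affineSpaceOver (Fin d) ℂ) → Fin d → ℂ) =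
      HostAPI.Carriers.AlgebraicGeometry.Motives.AlgPoints.affineCoords :=
  rfl

end ComplexPoints

theorem exists_isAnalytification_affineSpace_holds : exists_isAnalytification_affineSpace := by
  intro d
  refine ⟨HostAPI.Carriers.AlgebraicGeometry.Motives.AlgPoints.affinePoint ℂ, ⟨(HostAPI.Carriers.AlgebraicGeometry.Motives.ComplexPoints.affineHomeomorph d).isHomeomorph,
    Module.finrank_fin_fun ℂ, fun U s ↦ ?_⟩, HostAPI.Carriers.AlgebraicGeometry.Motives.AlgPoints.evalOrZero_coord_affinePoint⟩
  exact mdifferentiableOn_iff_differentiableOn.mpr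
    (HostAPI.Carriers.AlgebraicGeometry.Motives.ComplexPoints.differentiableOn_evalOrZero_affinePoint d U.1 s)

end HostAPI.Carriers.NumberTheory.Transcendental
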